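import Mathlib
import HarnessLib
import HarnessLib.Audit
import Summits.HodgeConjecture.HodgeConjecture.Statement
import Literature.AlgebraicGeometry.Motives.Cycles
import Literature.AlgebraicGeometry.Motives.Varieties
import Literature.AlgebraicGeometry.HodgeTheory.HodgeConjecture

/-!
Route: schlafli-minus-five

CLOSED (retired) 2026-08-15T13:48:18Z by operator:999:1257524 — reason: not-a-thesis: assembly does not conclude the sub-problem Statement — note: D-0027 §2.1 audit (human 2026-08-15: routes that do not decide the summit are removed): the assembly concludes `HodgeAllSmooth23`, not the sub-problem statement; a NEW conforming route may be opened from the same idea (generated `closes : … → _root_.HodgeConjecture`).. The file is kept as the record of this route; refuted decls are indexed as negative knowledge (`ledger negatives`).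

Route for idea card schlafli-minus-five (HodgeConjecture/HodgeConjecture). INSTANCE-FAMILY route:
its Target is the Hodge conjecture for every smooth complete intersection X = Q ∩ C of a quadric and
a cubic in P^8_C (dimension 6; H^6 has coniveau exactly 2, level 2), i.e. `HodgeAllSmooth23`; it
does NOT assemble to Summit HodgeConjecture and says so.
Thesis X (it suffices to show): CH_1(X) ⊗ Q has rank <= 1 (hence = Q·[line], CH_1,hom ⊗ Q = 0) for
the VERY GENERAL (2,3)-sixfold X ⊂ P^8 — Voisin's Bloch-type Conjecture 1.4 in the first coniveau-2
case beyond the Fano-scheme range (Tian–Zong Cor. 1.9 stops at Σ d_i(d_i+1)/2 <= n: 9 > 8).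
Lean (item ChowOneVeryGeneral23, elaborates, Sketch.lean rc 0): ∃ G : ℕ → MvPolynomial ((Fin 9 →₀ ℕ)
⊕ (Fin 9 →₀ ℕ)) ℂ, (each G i nonzero at some homogeneous pair (Q,C) of degrees (2,3)) ∧ ∀ X Q C ι,
(∀ i, eval (coeffs Q,C) (G i) ≠ 0) → IsSmoothProjective 6 X → Q.IsHomogeneous 2 → C.IsHomogeneous 3
→ IsClosedImmersion ι.left → range ι = V₊(Q,C) → (X in no hyperplane) → ∀ a b : ChowGroup X.left 1,
∃ m n : ℤ, (m ≠ 0 ∨ n ≠ 0) ∧ m • a = n • b.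
Why X suffices (all support, known-type): ChowZeroTrivial23 (Fano ⇒ RCC ⇒ CH_0 = Z, Campana/KMM,
Kollár IV.3.13) + ChowOneSpecialisation23 (spread the level-1 Paranjape decomposition mΔ = Z_0 + Z_1
+ Z_2 (Z_0 ⊂ X×pt, Z_1 ⊂ D×line, Z_2 ⊂ T×X, codim T >= 2) over a finite cover of an open of the
parameter space and specialise it with its support shape to EVERY smooth member, Voisin II
10.19–10.22 + Fulton §20.3 + Voisin2015 Thm 2.1 pattern) + LadderHodgeSix (k_0 = 1, n = 6: the
decomposition makes every Hodge class of degree 6 a Gysin image of a degree-2 Hodge class on a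
resolved fourfold T~, algebraic by Lefschetz (1,1); degrees 8, 10 by the transposed decomposition;
Paranjape1994/Laterveer1998/Voisin II 10.29–10.31 for Hodge CLASSES) ⇒ HodgeConjectureFor 6 X for
all smooth (2,3)-sixfolds. Assembly item = this chain, pure logic over the inlined statements.
ENGINE for X (the card; cruxes): every line m ⊂ X is Q-isotropic and lies in a P^3 = OG(2,5) of
maximal isotropic 3-planes Λ ⊂ Q; Σ_Λ = Λ ∩ C is a cubic surface with m among its 27 lines. On S~ =
{(Λ,m)} (27:1 over the spinor tenfold OG(4,9), a P^3-bundle over the K-trivial sevenfold F_1(X), so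
CH_0(S~) = CH_0(F_1)) the meeting correspondence T (m ↦ the 10 lines of Σ_Λ meeting m) satisfies
(T−10)(T+5)(T−1) = 0 (complement of the Schläfli graph) and, by the tritangent relation
[m]+[m']+[m''] = c_0 := [Π ∩ C] (Π isotropic plane; constant since OG(3,9) is rational), the
cylinder map Ψ : CH_0(S~) → CH_1(X) obeys Ψ∘T = −5Ψ on degree-0 cycles (support item
HeckeIdentity23, elaborates). Hence Ψ|hom factors through the −5 (E_6-reflection) isotypic piece.
Cruxes: HeckeRigidity23 (T acts on CH_0(S~)_hom,Q by its eigenvalue λ_7 on H^0(F_1, K) — generalized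
Bloch, Bai's Thm B template) and TopFormEigenvalue23 (F_1 strict CY with h^{7,0} = 1 and λ_7 ≠ −5).
Then CH_0,hom = (T+5)CH_0,hom is killed by Ψ: all lines Q-equivalent (crux
LinesEquivalentVeryGeneral23, elaborates); Tian–Zong Thm 1.7 (lines generate CH_1 for ALL smooth
(2,3) ⊂ P^8, support LinesGenerate23) gives X (glue ChowOneOfLines23).

Rationale: WHY THIS LINE. Decomposition of the diagonal is the one mechanism known to turn Chow triviality into
the Hodge conjecture, and (2,3) ⊂ P^8 is the first coniveau-2 family where the Chow input CH_1 ⊗ Q =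
Q is open (Voisin2009Coniveau2 Conj. 1.4; Voisin2013GHCBloch makes it follow from GHC only under the
Lefschetz standard conjecture; TianZong2014 Cor. 1.9 needs 9 <= 8). The card imports a
FINITE-GROUP/representation-theoretic object into the Chow problem: the W(E_6)-symmetric
configuration of the 27 lines on the cubic-surface slices Σ_Λ = Λ ∩ C by maximal isotropic 3-planes
of the quadric, acting as a Hecke correspondence T on 0-cycles of the incidence variety S~/OG(4,9)
with minimal polynomial (T−10)(T+5)(T−1). The identity Ψ∘T = −5Ψ (tritangent planes are isotropic;
plane sections are constant in CH_1 because OG(3,9) is rational) pins the line-cylinder map to the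
reflection isotypic piece, and a Bloch-type rigidity (Bai2024VoisinMaps Thm B is the worked
template: Ψ_* = −8 on CH_0(F_2(cubic 8-fold))_hom) reduces "all lines equivalent" to ONE number: the
eigenvalue λ_7 of T on the top form of the Calabi–Yau sevenfold F_1(X) must differ from −5. Areas
imported: classical geometry of cubic surfaces / E_6 (Dolgachev2012 Ch. 9), isotropic Grassmannians
(Reid/Tyurin), Bloch–Beilinson rigidity for K-trivial varieties (Voisin, Bai), specialisation of
cycles (Fulton1998 §20.3, Voisin2015UniversalCodim2 Thm 2.1).
RANKED CRUXES. r2 HeckeRigidity23 (informal until FanoSchemeOfLines / CorrespondenceChowAction land: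
T acts on CH_0(S~)_hom,Q by λ_7) — hardest, generalized-Bloch-hard. r3 TopFormEigenvalue23
(informal: F_1 strict CY, h^{7,0} = 1, λ_7 ≠ −5) — the one-symbol decision; cheapest informative
computation (Koszul–Bott on G(2,9); residual-line computation à la Bai Thm A). r4
LinesEquivalentVeryGeneral23 (Lean): any two lines of a very general X are Q-rationally equivalent —
the engine's output. r5 ChowOneVeryGeneral23 (Lean) = thesis X; reachable from r4 + TianZong2014 Thm
1.7 (glue ChowOneOfLines23) or independently (Voisin2009Coniveau2 Thm 1.9 via her effective-cone
Conj. 3.5; GHC + Lefschetz standard conjecture via Voisin2013GHCBloch).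
SUPPORT (known-type, filed so grounders/refuters can audit the renderings): HeckeIdentity23,
LinesGenerate23 (TZ 1.7, all smooth members), ChowOneOfLines23 (cycle algebra),
ChowOneSpecialisation23 (very general ⇒ all smooth members), LadderHodgeSix
(Paranjape1994SmallChow/Laterveer1998/VoisinHodgeII2003 10.29+10.31 for Hodge classes, k_0 = 1, n =
6), ChowZeroTrivial23 (Kollar1996 IV.3.13), Target HodgeAllSmooth23, Assembly (pure logic).
KILL CRITERIA. (i) λ_7 = −5, or h^{k,0}(F_1) ≠ 0 for some 0<k<7 with T-eigenvalue −5 on it: the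
mechanism stalls (route keeps X as a bare Chow crux but loses its engine — close as exhausted unless
another engine appears). (ii) A refutation of HeckeIdentity23 as rendered (e.g. closure of T over
singular slices breaking the count) forces a restatement, not a close. (iii) A smooth (2,3)-sixfold
with CH_1 ⊗ Q of rank >= 2 refutes X and Bloch–Beilinson; a very general one refutes the route
outright. (iv) Refutation of LadderHodgeSix or ChowOneSpecialisation23 as rendered = rendering bug
(restate).
STATE OF KNOWLEDGE (numbers). dim F_1 = 2·7 − (3+4) = 7, K_{F_1} = (−9 + 3 + 6)σ_1 = 0; dim OG(4,9)
= 10, dim OG(3,9) = 12, Λ ⊃ m: OG(2,5) ≅ P^3; meeting graph of 27 lines = srg(27,10,1,5), spectrum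
10^1, 1^20, (−5)^6; lines through a point of X: dimension 8−1−5 = 2; coniveau(H^6_prim) = 2 exactly
(8 = 5+3 < 5+6). HC for the Zariski-general member is empty of content (no primitive Hodge classes
by monodromy); the content is the SPECIAL members, reached by specialising the generic decomposition
(Terasoma1990/Shimada2003VanishingCyclesGHC treat only general members, for cubic 8-folds).
DELIBERATELY NOT DECOMPOSED YET: the internal steps of HeckeRigidity23 (constant-cycle subvarieties
of S~, CH_1(F_1) input as in Bai §3), the closure of T over the discriminant of singular slices
(auditor's flag K0'), the W(D_5)/W(E_7) variants ((2,2,·) and degree-2 del Pezzo slices) and the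
cubic-fourfold prediction (Ψ|hom ⊂ E_{−5} against Shen–Vial) named in the card's SCOPE; definition
requests FanoSchemeOfLines, CorrespondenceChowAction filed for the informal cruxes.
NOVELTY: see --novelty (nearest prior: Bai2024VoisinMaps, Shen arXiv:1102.2550, TianZong2014,
Voisin2009Coniveau2; grade claimed new-combination, auditor-confirmed 2026-08-15).
BARRIERS: see --barriers (BlochSrinivas1983 diagonal barrier met by design: h^{p,q} = 0 for q <= 1
on the target; integral-coefficient, GHC-level, Griffiths-group, normal-function and
exceptional-class barriers addressed there).

Novelty: NOVELTY (search-before-claim; searches run 2026-08-15 by the ideate author, the novelty auditor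
refuter-novelty-audit-HodgeConjecture-HodgeConjecture-8-0, and this planner).
Nearest prior art actually found and read:
- Bai2024VoisinMaps = arXiv:2404.10138 (READ pp.1-3, 10-12, 16): Thm A (Voisin self-MAP Ψ of
F_r(cubic) acts by (−2)^{r+1} on H^0(K)), Thm B (Ψ_* = −8 on CH_0(F_2(general cubic 8-fold))_hom),
Conj. 1.5/1.10 (generalized Bloch), Thm 3.6 (CH_1(F_1(cubic 8-fold))_Q = Q). The rigidity TEMPLATE;
no Hecke correspondences, no quadrics, no (2,3), no cylinder maps to CH_1 of the hypersurface.
- Shen, arXiv:1102.2550 (J. Algebraic Geom. 23 (2014) 539-569): relations among 1-cycles on cubic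
hypersurfaces from coplanar triples [l]+[l']+[l''] = plane-section class — our tritangent relation
is this relation on the cubic-surface slices Σ_Λ; Shen has no quadric/isotropic structure and no
eigenspace decomposition.
- TianZong2014 = arXiv:1209.4342 (READ Thm 1.6/1.7/Cor 1.9/Rem 1.10): lines generate CH_1 of smooth
CIs with Σd_i <= n−1; CH_1 = Z when Σ d_i(d_i+1)/2 <= n (fails for (2,3) ⊂ P^8: 9 > 8).
- Voisin2009Coniveau2 = arXiv:0809.0870 (READ §1): coniveau-2 CIs, Conj. 1.4 (CH_i,hom,Q = 0, i <=
c−1) 'not known in this range'; her alternative engine = effective-cone Conj. 3.5 on F and Thm 1.9.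
Voisin2013GHCBloch = arXiv:1107.2600 (READ pp.1-4): GHC ⇒ Bloch for general CIs CONDITIONAL on the
Lefschetz standard conjecture.
- DebarreManivel1998 (Fano schemes of CIs: dimension, conne  [refs: 10.1215/kjm/1250518004, 10.1007/s002080050235, 2404.10138, 1102.2550, 1209.4342, 0809.0870, 1107.2600, doi:10.1215/kjm/1250518004, doi:10.1007/s002080050235, TianZong2014, DebarreManivel1998, Laterveer1998, VoisinHodgeII2003, Terasoma1990, Dolgachev2012, VoisinChowRings2014]

Barriers (technique_class: decomposition-of-the-diagonal, hecke-correspondence): Literature.Barriers.HodgeConjecture.BlochSrinivas1983_hodgeTypeL0_vanish_of_chowZeroSupported: MET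
BY DESIGN, not evaded — the ladder (decomposition of the diagonal with k_0 = 1) is applied only to
(2,3)-sixfolds, whose H^6 has h^{6,0} = h^{5,1} = 0 (coniveau 2 = level 2, Voisin2009Coniveau2 Thm
1.3: 8 >= 5+3), exactly the zone where Thm 10.31 permits CH_0, CH_1 ⊗ Q to be trivial; the barrier
is the declared boundary of the route (no CY/abelian/HK/general-type targets; the summit is NOT
claimed), and its 'correspondences-acting-on-forms' mechanism is used positively (HeckeRigidity23 is
a generalized-Bloch statement on the CY sevenfold F_1, where h^{7,0} ≠ 0 is the resource, not an
obstruction).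
Literature.Barriers.HodgeConjecture.Grothendieck1969_generalHodgeConjecture_false: only
Grothendieck's corrected SUPPORT form (GHC in coniveau 2 for H^6_prim, as a by-product of the
specialised decomposition: H^6 supported on the codimension-2 set T) is touched; no level-wise
(Hodge's original) claim is made.
Literature.Barriers.HodgeConjecture.Clemens1983_griffithsGroup_infiniteRank: compatible — CH_1 ⊗ Q =
Q on the sixfold coexists with infinitely generated Griffiths groups of its hyperplane sections; no
finite-generation, representability or Néron–Severi analogy is used for cycles of codimension > 1.
Literature.Barriers.HodgeConjecture.Voisin2003_generalHypersurface_noIntegralClassInF: evaded — no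
Lefschetz pencil, no normal functions, no Jacobi inversion; Hodge classes of special m

Novelty grade: known — Route review regrade (refuter-rreview-route-HodgeConjecture-sc-ccabbba3-0, 2026-08-15). The route's THESIS X (CH_1(X)⊗Q of rank<=1 for very general (2,3)⊂P^8) and its TARGET (HC for every smooth (2,3) sixfold) are published as such: HirschowitzIyer2010 §1.6 (re-read p.3-4 of arXiv:0903.5018: rho+r = (refuter refuter-rreview-route-HodgeConjecture-sc-ccabbba3-0, 2026-08-15T12:10:42Z; prior: arXiv:0903.5018 = doi:10.1090/conm/522/10291 HirschowitzIyer2010 Main Thm §1.6 at (n,r,s,d)=(8,1,2,(2,3)): QCH_1 of ANY (2,3) pair in P^8 is trivial — thesis X verbatim, all smooth members, arXiv:1203.2650 Vial2013 Doc. Math. 18, Thm 7.1(i) (=Laterveer1998 J. Math. Kyoto 38) + §7.2.4 + Prop 7.7: HC for (2,3) CIs of dim>=6 (and varieties fibred in them) — the target, EsnaultLevineViehweg1997 / Roit)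

History (route lifecycle, newest last):
- 2026-08-15T13:48:18Z · CLOSED retired — not-a-thesis: assembly does not conclude the sub-problem Statement (operator:999:1257524)

sub-problem: HodgeConjecture · status: closed(retired) · opened planner-plancard-HodgeConjecture-HodgeConject-9e662364-0 2026-08-15T10:58:44Z · rev 0 · ledger route-HodgeConjecture-schlafli-minus-five
GENERATED by the gate from the ledger (D-0016/17). Provers cite these decls: `theorem foo : Summit.HodgeConjecture.HodgeConjecture.Theses.SchlafliMinusFive.<Decl> := …` in Summits/HodgeConjecture/HodgeConjecture/Theorems/<Name>.lean.
-/

namespace Summit.HodgeConjecture.HodgeConjecture.Theses.SchlafliMinusFive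

open scoped BigOperators Topology Manifold Classical MeasureTheory ProbabilityTheory Matrix InnerProductSpace ComplexConjugate ContinuousMap
open Filter Set Function TopologicalSpace MeasureTheory

attribute [summit_statement] _root_.HodgeConjecture

/-- item stmt-HodgeConjecture-1781 · target · rank 0 · closed · moot by None · by planner
why it might fail: Theorem in print: Vial2013 Thm 7.1(i) (= Laterveer1998; d=6, l=1) o CH_0: Roitman/ELV1997 (Sum d_i = 5 <= 8) o CH_1: HirschowitzIyer2010 at (8,1,2,(2,3)) (Vial 7.2.4). Residual risk only: H-I's exact boundary case rho+r = n-s, and the rendering bridge X = V(Q,C) => IsSmoothCompleteIntersection.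
sources: Vial2013, Laterveer1998, HirschowitzIyer2010, EsnaultLevineViehweg1997
[target] The Hodge conjecture (Literature.AlgebraicGeometry.HodgeTheory.HodgeConjectureFor 6 X) for
EVERY smooth complete intersection X = V(Q) ∩ V(C) ⊂ P^8_C of a quadric and a cubic (rendered: X
smooth projective geometrically irreducible of dimension 6 with a closed immersion onto the zero
locus V_+(Q, C), contained in no hyperplane — this pins X ≅ V(Q,C) scheme-theoretically: a
nondegenerate smooth irreducible sixfold of P^8 has degree >= 6 = deg V(Q,C), so V(Q,C) is
generically reduced, Cohen–Macaulay, hence reduced). Instance family of Summit HodgeConjecture (NOT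
the summit): H^6 has coniveau exactly 2 (Voisin2009Coniveau2 Thm 1.3), h^{6,0} = h^{5,1} = 0;
content lies in the special members (Hodge loci), the very general member having no primitive Hodge
classes. Why it might fail: only if HC fails; the route's risk is provability. Sources: Deligne2000
§1; Voisin2009Coniveau2 Thm 1.3, Conj 1.4; Terasoma1990 (cubic 8-folds, general members only). -/
@[route_item "route-HodgeConjecture-schlafli-minus-five"]
def HodgeAllSmooth23 : Prop :=
  letI := MvPolynomial.gradedAlgebra (σ := Fin (8 + 1)) (R := ℂ); ∀ ⦃X : Literature.AlgebraicGeometry.Motives.SchemeOver ℂ⦄ (Q C : MvPolynomial (Fin (8 + 1)) ℂ) (ι : X ⟶ Literature.AlgebraicGeometry.Motives.projectiveSpace 8 ℂ), Literature.AlgebraicGeometry.Motives.IsSmoothProjective 6 X → Q.IsHomogeneous 2 → C.IsHomogeneous 3 → AlgebraicGeometry.IsClosedImmersion ι.left → Set.range ι.left.base = ProjectiveSpectrum.zeroLocus (MvPolynomial.homogeneousSubmodule (Fin (8 + 1)) ℂ) {Q, C} → (∀ H : MvPolynomial (Fin (8 + 1)) ℂ, H.IsHomogeneous 1 → H ≠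 0 → ¬ (Set.range ι.left.base ⊆ ProjectiveSpectrum.zeroLocus (MvPolynomial.homogeneousSubmodule (Fin (8 + 1)) ℂ) {H})) → Literature.AlgebraicGeometry.HodgeTheory.HodgeConjectureFor 6 X

-- item stmt-HodgeConjecture-1941 · crux · rank 2 · closed · moot by None · by planner — informal only, no Lean statement yet:
--   [crux] (rank 2a — hardest) HECKE RIGIDITY for a very general (2,3)-sixfold X = V(Q,C) ⊂ P^8_C.
--   Objects: F = F_1(X) ⊂ G(2,9), the smooth K-trivial sevenfold of lines (zero scheme of a section of
--   Sym^2 S^∨ ⊕ Sym^3 S^∨); S~ = {(Λ, m) : Λ ∈ OG(4,9) a maximal Q-isotropic 3-plane, m a line of Σ_Λ =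
--   Λ ∩ C} — generically 27:1 over the spinor tenfold OG(4,9) (monodromy W(E_6)) and an OG(2,5) ≅
--   P^3-bundle over F, so CH_0(S~) = CH_0(F); T = T_meet ⊂ S~ ×_{OG(4,9)} S~ the finite relative
--   correspondence (Λ, m) ↦ Σ of the 10 lines of Σ_Λ meeting m, CLOSED UP over the discriminant divisor
--   of singular slices.

-- item stmt-HodgeConjecture-1942 · crux · rank 2 · closed · moot by None · by planner — informal only, no Lean statement yet:
--   [crux] (rank 2b — the one-symbol decision; cheapest informative computation, do FIRST) TOP-FORM
--   EIGENVALUE for a general (2,3)-sixfold X ⊂ P^8_C: (K0) F_1(X) ⊂ G(2,9) is smooth of the expected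
--   dimension 2·7 − (3+4) = 7 with K = (−9+3+6)σ_1 = 0, simply connected, and a STRICT Calabi–Yau
--   sevenfold: h^{k,0}(F_1) = 0 for 0 < k < 7 and h^{7,0} = 1 (Koszul complex of Sym^2 S^∨ ⊕ Sym^3 S^∨
--   on G(2,9) + Bott vanishing; Debarre–Manivel Lefschetz-type theorem H^i(G) ≅ H^i(F_1) in low degrees;
--   Beauville–Bogomolov to exclude torus/hyper-Kähler factors); every line of X lies in a maximal
--   isotropic Λ with Σ_

/-- item stmt-HodgeConjecture-1782 · support · rank 4 · closed · moot by None · by planner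
why it might fail: Known for ALL smooth members (HirschowitzIyer2010 at the exact boundary rho+r = n-s of its range, restated by Vial2013 7.2.4); tree-side only: needs deg : CH_1(X) -> Z (or Bezout) for the equal-degree step.
sources: HirschowitzIyer2010, arXiv:0903.5018, Vial2013
[crux] ENGINE OUTPUT of the card: for (Q, C) outside a countable union of proper algebraic subsets
of the coefficient space (rendered: a sequence G_i of polynomials in the coefficients, each
non-vanishing at some homogeneous pair), any two lines m, m' ⊂ X = V(Q,C) (rendered: points z of X
of height 1 whose closure maps onto a linear P^1 = V_+(7 independent linear forms)) are Q-rationally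
equivalent as 1-cycles on X: ∃ k > 0, k[m] ~_rat k[m']. Mechanism: HeckeIdentity23 gives Ψ∘(T+5) =
const on CH_0(S~); HeckeRigidity23 + TopFormEigenvalue23 give CH_0(S~)_hom,Q = (T+5) CH_0(S~)_hom,Q
(λ_7 ≠ −5); hence Ψ(CH_0,hom) = 0, i.e. all lines have the same class in CH_1(X)_Q (F_1(X)
connected, DebarreManivel1998). Why it might fail: the rigidity step is generalized-Bloch-hard and
λ_7 may equal −5 (engine stalls; statement still predicted by Bloch–Beilinson since coniveau(H^6) =
2). Sources: Bai2024VoisinMaps Thm A/B; TianZong2014 Cor 1.9 (why the RCC argument stops: 9 > 8);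
Voisin2009Coniveau2 Conj 1.4; Dolgachev2012 Ch. 9. -/
@[route_item "route-HodgeConjecture-schlafli-minus-five"]
def LinesEquivalentVeryGeneral23 : Prop :=
  letI := MvPolynomial.gradedAlgebra (σ := Fin (8 + 1)) (R := ℂ); ∃ G : ℕ → MvPolynomial ((Fin (8 + 1) →₀ ℕ) ⊕ (Fin (8 + 1) →₀ ℕ)) ℂ, (∀ i, ∃ Q C : MvPolynomial (Fin (8 + 1)) ℂ, Q.IsHomogeneous 2 ∧ C.IsHomogeneous 3 ∧ MvPolynomial.eval (Sum.elim (fun e => Q.coeff e) (fun e => C.coeff e)) (G i) ≠ 0) ∧ ∀ ⦃X : Literature.AlgebraicGeometry.Motives.SchemeOver ℂ⦄ (Q C : MvPolynomial (Fin (8 + 1)) ℂ) (ι : X ⟶ Literature.AlgebraicGeometry.Motives.projectiveSpace 8 ℂ), (∀ i, MvPolynomial.eval (Sum.elim (fun e => Q.coeff e) (fun e => C.coeff e)) (G i) ≠ 0) → Literature.AlgebraicGeometry.Motives.IsSmoothProjective 6 X → Q.IsHomogeneous 2 → C.IsHomogeneous 3 → AlgebraicGeometry.IsClosedImmersion ι.left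 → Set.range ι.left.base = ProjectiveSpectrum.zeroLocus (MvPolynomial.homogeneousSubmodule (Fin (8 + 1)) ℂ) {Q, C} → (∀ H : MvPolynomial (Fin (8 + 1)) ℂ, H.IsHomogeneous 1 → H ≠ 0 → ¬ (Set.range ι.left.base ⊆ ProjectiveSpectrum.zeroLocus (MvPolynomial.homogeneousSubmodule (Fin (8 + 1)) ℂ) {H})) → ∀ z z' : X.left, (Order.height z = 1 ∧ ∃ L : Fin 7 → MvPolynomial (Fin (8 + 1)) ℂ, LinearIndependent ℂ L ∧ (∀ j, (L j).IsHomogeneous 1) ∧ ⇑ι.left.base '' closure {z} = ProjectiveSpectrum.zeroLocus (MvPolynomial.homogeneousSubmodule (Fin (8 + 1)) ℂ) (Set.range L)) → (Order.height z' = 1 ∧ ∃ L : Fin 7 → MvPolynomial (Fin (8 + 1)) ℂ, LinearIndependent ℂ L ∧ (∀ j, (L j).IsHomogeneous 1) ∧ ⇑ι.left.base '' closure {z'} = ProjectiveSpectrum.zeroLocus (MvPolynomial.homogeneousSubmodule (Fin (8 + 1)) ℂ) (Set.range L)) → ∃ m : ℕ, 0 < m ∧ Literature.AlgebraicGeometry.Motives.IsRationallyEquivalent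 (m • Literature.AlgebraicGeometry.Motives.primeCycle z) (m • Literature.AlgebraicGeometry.Motives.primeCycle z') 1

/-- item stmt-HodgeConjecture-1783 · support · rank 5 · closed · moot by None · by planner
why it might fail: Known (HirschowitzIyer2010 1.6 at (8,1,2,(2,3)), boundary case rho+r = n-s; corroborated by Vial2013 7.2.4); only tree-side risk: the rendering bridge X = V(Q,C) (closed immersion, nondegenerate) => complete-intersection pair hypotheses of H-I.
sources: HirschowitzIyer2010, Vial2013, EsnaultLevineViehweg1997
[crux] THESIS X: for very general (Q, C) (same rendering as LinesEquivalentVeryGeneral23), CH_1(X) ⊗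
Q has rank <= 1 (∀ a b ∈ CH_1(X), ∃ (m,n) ≠ (0,0), m a = n b; with any curve of positive degree this
is CH_1(X)_Q = Q·[line], CH_1,hom,Q = 0) — Voisin's Conjecture 1.4 (Bloch–Beilinson) for the first
coniveau-2 family beyond the Fano-scheme range. Reached from LinesEquivalentVeryGeneral23 +
LinesGenerate23 by the glue ChowOneOfLines23, or independently (Voisin2009Coniveau2 Thm 1.9 via her
effective-cone Conjecture 3.5 on F_1; Voisin2013GHCBloch: GHC + Lefschetz standard conjecture).
Shared currency with the companion frame card coniveau-ladder-cubic-eightfolds (its rung (a)). Why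
it might fail: only with Bloch–Beilinson; the risk is that every known engine stops exactly here.
Sources: Voisin2009Coniveau2 Conj 1.4, Thm 1.9; Voisin2013GHCBloch Thm 0.x (conditional);
TianZong2014 Thm 1.7, Rem 1.10; VoisinChowRings2014 Ch. 4. -/
@[route_item "route-HodgeConjecture-schlafli-minus-five"]
def ChowOneVeryGeneral23 : Prop :=
  letI := MvPolynomial.gradedAlgebra (σ := Fin (8 + 1)) (R := ℂ); ∃ G : ℕ → MvPolynomial ((Fin (8 + 1) →₀ ℕ) ⊕ (Fin (8 + 1) →₀ ℕ)) ℂ, (∀ i, ∃ Q C : MvPolynomial (Fin (8 + 1)) ℂ, Q.IsHomogeneous 2 ∧ C.IsHomogeneous 3 ∧ MvPolynomial.eval (Sum.elim (fun e => Q.coeff e) (fun e => C.coeff e)) (G i) ≠ 0) ∧ ∀ ⦃X : Literature.AlgebraicGeometry.Motives.SchemeOver ℂ⦄ (Q C : MvPolynomial (Fin (8 + 1)) ℂ) (ι : X ⟶ Literature.AlgebraicGeometry.Motives.projectiveSpace 8 ℂ), (∀ i, MvPolynomial.eval (Sum.elim (fun e => Q.coeff e) (fun e => C.coeff e)) (G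 i) ≠ 0) → Literature.AlgebraicGeometry.Motives.IsSmoothProjective 6 X → Q.IsHomogeneous 2 → C.IsHomogeneous 3 → AlgebraicGeometry.IsClosedImmersion ι.left → Set.range ι.left.base = ProjectiveSpectrum.zeroLocus (MvPolynomial.homogeneousSubmodule (Fin (8 + 1)) ℂ) {Q, C} → (∀ H : MvPolynomial (Fin (8 + 1)) ℂ, H.IsHomogeneous 1 → H ≠ 0 → ¬ (Set.range ι.left.base ⊆ ProjectiveSpectrum.zeroLocus (MvPolynomial.homogeneousSubmodule (Fin (8 + 1)) ℂ) {H})) → (∀ a b : Literature.AlgebraicGeometry.Motives.ChowGroup X.left 1, ∃ m n : ℤ, (m ≠ 0 ∨ n ≠ 0) ∧ m • a = n • b)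

/-- item stmt-HodgeConjecture-1784 · support · rank 9 · closed · moot by None · by planner
why it might fail: Elementary; fails only through the rendering (e.g. if 'exactly 27 lines' did not force Σ_Λ smooth — it does: singular normal cubic surfaces have <= 21 lines, non-normal ones infinitely many).
sources: Dolgachev2012, arXiv:1102.2550, Fulton1998
[support] THE −5 IDENTITY (elementary; documents the engine). For a maximal Q-isotropic 3-plane Λ =
V_+(5 independent linear forms) ⊂ V(Q) whose slice Σ_Λ = Λ ∩ X = Λ ∩ C carries exactly 27 lines (⇔
Σ_Λ is a smooth cubic surface) and a line m of Σ_Λ, the 1-cycle 5[m] + Σ_{m' ⊂ Σ_Λ, m' ≠ m, m' ∩ m ≠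
∅} [m'] on X has a class in CH_1(X) independent of (Λ, m) (it equals 5 c_0, c_0 = [Π ∩ C] for any
isotropic plane Π ⊄ X). Proof sketch: the 10 lines meeting m pair off in the 5 tritangent planes Π_i
⊂ Λ through m, Π_i ∩ C = m + m_i' + m_i'' as cycles (Shen-type coplanar relation on the slice), Π_i
is isotropic, and [Π ∩ C] ∈ CH_1(X) is constant because the isotropic planes not in C form an open
subset of the rational homogeneous OG(3,9) (flat family of plane cubics; Fulton1998 §1.6/§10.1).
Consequence: with T = meeting correspondence on S~ = {(Λ,m)}, Ψ∘T = 5·deg(−)·c_0 − 5Ψ, so the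
cylinder map kills the T-eigenspaces 10 and 1 on degree-0 cycles ((T−10)(T+5)(T−1) = 0: complement
of the Schläfli graph srg(27,16,10,8), spectrum 10, 1, −5 with multiplicities 1, 20, 6 = trivial ⊕
20-dim ⊕ E_6-reflection). Holds for EVERY smooth (2,3)-sixfold (no genericity). Why it might fail:
only by a rend -/
@[route_item "route-HodgeConjecture-schlafli-minus-five"]
def HeckeIdentity23 : Prop :=
  letI := MvPolynomial.gradedAlgebra (σ := Fin (8 + 1)) (R := ℂ); ∀ ⦃X : Literature.AlgebraicGeometry.Motives.SchemeOver ℂ⦄ (Q C : MvPolynomial (Fin (8 + 1)) ℂ) (ι : X ⟶ Literature.AlgebraicGeometry.Motives.projectiveSpace 8 ℂ), Literature.AlgebraicGeometry.Motives.IsSmoothProjective 6 X → Q.IsHomogeneous 2 → C.IsHomogeneous 3 → AlgebraicGeometry.IsClosedImmersion ι.left → Set.range ι.left.base = ProjectiveSpectrum.zeroLocus (MvPolynomial.homogeneousSubmodule (Fin (8 + 1)) ℂ) {Q, C} → (∀ H : MvPolynomial (Fin (8 + 1)) ℂ, H.IsHomogeneous 1 → H ≠ 0 → ¬ (Set.range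 ι.left.base ⊆ ProjectiveSpectrum.zeroLocus (MvPolynomial.homogeneousSubmodule (Fin (8 + 1)) ℂ) {H})) → ∀ (Λ₁ Λ₂ : Fin 5 → MvPolynomial (Fin (8 + 1)) ℂ) (F₁ F₂ : Finset X.left) (m₁ m₂ : X.left), (LinearIndependent ℂ Λ₁ ∧ (∀ j, (Λ₁ j).IsHomogeneous 1) ∧ ProjectiveSpectrum.zeroLocus (MvPolynomial.homogeneousSubmodule (Fin (8 + 1)) ℂ) (Set.range Λ₁) ⊆ ProjectiveSpectrum.zeroLocus (MvPolynomial.homogeneousSubmodule (Fin (8 + 1)) ℂ) {Q} ∧ F₁.card = 27 ∧ ∀ z : X.left, z ∈ F₁ ↔ ((Order.height z = 1 ∧ ∃ L : Fin 7 → MvPolynomial (Fin (8 + 1)) ℂ, LinearIndependent ℂ L ∧ (∀ j, (L j).IsHomogeneous 1) ∧ ⇑ι.left.base '' closure {z} = ProjectiveSpectrum.zeroLocus (MvPolynomial.homogeneousSubmodule (Fin (8 + 1)) ℂ) (Set.range L)) ∧ ⇑ι.left.base '' closure {z} ⊆ ProjectiveSpectrum.zeroLocus (MvPolynomial.homogeneousSubmodule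 (Fin (8 + 1)) ℂ) (Set.range Λ₁))) → (LinearIndependent ℂ Λ₂ ∧ (∀ j, (Λ₂ j).IsHomogeneous 1) ∧ ProjectiveSpectrum.zeroLocus (MvPolynomial.homogeneousSubmodule (Fin (8 + 1)) ℂ) (Set.range Λ₂) ⊆ ProjectiveSpectrum.zeroLocus (MvPolynomial.homogeneousSubmodule (Fin (8 + 1)) ℂ) {Q} ∧ F₂.card = 27 ∧ ∀ z : X.left, z ∈ F₂ ↔ ((Order.height z = 1 ∧ ∃ L : Fin 7 → MvPolynomial (Fin (8 + 1)) ℂ, LinearIndependent ℂ L ∧ (∀ j, (L j).IsHomogeneous 1) ∧ ⇑ι.left.base '' closure {z} = ProjectiveSpectrum.zeroLocus (MvPolynomial.homogeneousSubmodule (Fin (8 + 1)) ℂ) (Set.range L)) ∧ ⇑ι.left.base '' closure {z} ⊆ ProjectiveSpectrum.zeroLocus (MvPolynomial.homogeneousSubmodule (Fin (8 + 1)) ℂ) (Set.range Λ₂))) → m₁ ∈ F₁ → m₂ ∈ F₂ → Literature.AlgebraicGeometry.Motives.IsRationallyEquivalent (5 • Literature.AlgebraicGeometry.Motives.primeCycle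 m₁ + ∑ z ∈ F₁.filter (fun z => z ≠ m₁ ∧ (closure {z} ∩ closure {m₁} : Set X.left).Nonempty), Literature.AlgebraicGeometry.Motives.primeCycle z) (5 • Literature.AlgebraicGeometry.Motives.primeCycle m₂ + ∑ z ∈ F₂.filter (fun z => z ≠ m₂ ∧ (closure {z} ∩ closure {m₂} : Set X.left).Nonempty), Literature.AlgebraicGeometry.Motives.primeCycle z) 1

/-- item stmt-HodgeConjecture-1785 · support · rank 9 · closed · moot by None · by planner
why it might fail: Published theorem (TianZong2014 Thm 1.7); only the rendering of 'line' could be off.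
sources: TianZong2014, Kollar1996
[support] Tian–Zong, Compositio 150 (2014), Thm 1.7 (READ p.3): for a smooth complete intersection
of type (d_1,…,d_c) in P^n over an algebraically closed field of characteristic 0 with Σ d_i <= n−1,
CH_1(X) is generated by lines — here (2,3) ⊂ P^8, 5 <= 7, for ALL smooth members (no genericity).
Rendered with a harmless positive multiple m (TZ prove m = 1): every 1-cycle c has m·c rationally
equivalent to a Z-combination of prime cycles of lines. To be vendored as a Literature named fact
(cite item filed); provers may then restate fact-relative. Why it might fail: published theorem;
rendering risk only (lines as height-1 points with linear image). Sources: TianZong2014 Thm 1.7, Rem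
1.10; Kollar1996 V.4.2 (Q-version). -/
@[route_item "route-HodgeConjecture-schlafli-minus-five"]
def LinesGenerate23 : Prop :=
  letI := MvPolynomial.gradedAlgebra (σ := Fin (8 + 1)) (R := ℂ); ∀ ⦃X : Literature.AlgebraicGeometry.Motives.SchemeOver ℂ⦄ (Q C : MvPolynomial (Fin (8 + 1)) ℂ) (ι : X ⟶ Literature.AlgebraicGeometry.Motives.projectiveSpace 8 ℂ), Literature.AlgebraicGeometry.Motives.IsSmoothProjective 6 X → Q.IsHomogeneous 2 → C.IsHomogeneous 3 → AlgebraicGeometry.IsClosedImmersion ι.left → Set.range ι.left.base = ProjectiveSpectrum.zeroLocus (MvPolynomial.homogeneousSubmodule (Fin (8 + 1)) ℂ) {Q, C} → (∀ H : MvPolynomial (Fin (8 + 1)) ℂ, H.IsHomogeneous 1 → H ≠ 0 → ¬ (Set.range ι.left.base ⊆ ProjectiveSpectrum.zeroLocus (MvPolynomial.homogeneousSubmodule (Fin (8 + 1)) ℂ) {H})) → ∀ c ∈ Literature.AlgebraicGeometry.Motives.cyclesOfDim X.left 1, ∃ m : ℕ, 0 < m ∧ ∃ (s : Finset X.left) (w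 : X.left → ℤ), (∀ z ∈ s, (Order.height z = 1 ∧ ∃ L : Fin 7 → MvPolynomial (Fin (8 + 1)) ℂ, LinearIndependent ℂ L ∧ (∀ j, (L j).IsHomogeneous 1) ∧ ⇑ι.left.base '' closure {z} = ProjectiveSpectrum.zeroLocus (MvPolynomial.homogeneousSubmodule (Fin (8 + 1)) ℂ) (Set.range L))) ∧ Literature.AlgebraicGeometry.Motives.IsRationallyEquivalent (m • c) (∑ z ∈ s, w z • Literature.AlgebraicGeometry.Motives.primeCycle z) 1

/-- item stmt-HodgeConjecture-1786 · support · rank 9 · closed · moot by None · by planner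
why it might fail: Known technique (spread + specialise the level-1 decomposition of the diagonal); risk only in bookkeeping: uniform integer m over a finite cover of an open of the base, and flat closure of the cycles over a DVR keeping the support shape D × line.
sources: VoisinHodgeII2003, Fulton1998, Voisin2015UniversalCodim2, BlochSrinivas1983
[support] SHAPED SPECIALISATION (frame, known technique): if CH_1 ⊗ Q has rank <= 1 for the very
general (2,3)-sixfold then it has rank <= 1 for EVERY smooth (2,3)-sixfold X_0 ⊂ P^8. Proof pattern:
over the generic point of the parameter space the Bloch–Srinivas lemma (VoisinHodgeII2003 Thm 10.19,
Cor 10.20–10.22; countability + Hilbert schemes, finite base change) gives m Δ = Z_0 + Z_1 + Z_2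
with Z_0 ⊂ X × {x_0}, Z_1 ⊂ D × ℓ (D a divisor, ℓ a LINE — choose the support curve to be a line,
lines dominate the base), Z_2 ⊂ T × X with codim T >= 2, valid over a finite cover of a Zariski open
U; specialise along a DVR through X_0 (Fulton1998 §20.3; Voisin2015UniversalCodim2 Thm 2.1 is the
k_0 = 0 model): supports specialise to a point, D_0 × ℓ_0 (limits of lines are lines) and T_0 × X_0
with codim T_0 >= 2. Acting on z ∈ CH_1(X_0): Z_0,* z = 0 (1-cycle supported on a point), Z_2,* z =
0 (move z off T_0: 1 + 4 < 6), Z_1,* z ∈ Z[ℓ_0]; so m z ∈ Z[ℓ_0]. Why it might fail: standard but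
unwritten for k_0 = 1 with Q-coefficients; the uniform m over a finite cover and the flatness of the
closures over the DVR are the points to write first. Sources: VoisinHodgeII2003 §10.2.1–10.2.2;
Fulton1998 § -/
@[route_item "route-HodgeConjecture-schlafli-minus-five"]
def ChowOneSpecialisation23 : Prop :=
  letI := MvPolynomial.gradedAlgebra (σ := Fin (8 + 1)) (R := ℂ); (∃ G : ℕ → MvPolynomial ((Fin (8 + 1) →₀ ℕ) ⊕ (Fin (8 + 1) →₀ ℕ)) ℂ, (∀ i, ∃ Q C : MvPolynomial (Fin (8 + 1)) ℂ, Q.IsHomogeneous 2 ∧ C.IsHomogeneous 3 ∧ MvPolynomial.eval (Sum.elim (fun e => Q.coeff e) (fun e => C.coeff e)) (G i) ≠ 0) ∧ ∀ ⦃X : Literature.AlgebraicGeometry.Motives.SchemeOver ℂ⦄ (Q C : MvPolynomial (Fin (8 + 1)) ℂ) (ι : X ⟶ Literature.AlgebraicGeometry.Motives.projectiveSpace 8 ℂ), (∀ i, MvPolynomial.eval (Sum.elim (fun e => Q.coeff e) (fun e => C.coeff e)) (G i) ≠ 0) → Literature.AlgebraicGeometry.Motives.IsSmoothProjective 6 X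 → Q.IsHomogeneous 2 → C.IsHomogeneous 3 → AlgebraicGeometry.IsClosedImmersion ι.left → Set.range ι.left.base = ProjectiveSpectrum.zeroLocus (MvPolynomial.homogeneousSubmodule (Fin (8 + 1)) ℂ) {Q, C} → (∀ H : MvPolynomial (Fin (8 + 1)) ℂ, H.IsHomogeneous 1 → H ≠ 0 → ¬ (Set.range ι.left.base ⊆ ProjectiveSpectrum.zeroLocus (MvPolynomial.homogeneousSubmodule (Fin (8 + 1)) ℂ) {H})) → (∀ a b : Literature.AlgebraicGeometry.Motives.ChowGroup X.left 1, ∃ m n : ℤ, (m ≠ 0 ∨ n ≠ 0) ∧ m • a = n • b)) → ∀ ⦃X : Literature.AlgebraicGeometry.Motives.SchemeOver ℂ⦄ (Q C : MvPolynomial (Fin (8 + 1)) ℂ) (ι : X ⟶ Literature.AlgebraicGeometry.Motives.projectiveSpace 8 ℂ), Literature.AlgebraicGeometry.Motives.IsSmoothProjective 6 X → Q.IsHomogeneous 2 → C.IsHomogeneous 3 → AlgebraicGeometry.IsClosedImmersion ι.left → Set.range ι.left.base = ProjectiveSpectrum.zeroLocus (MvPolynomial.homogeneousSubmodule (Fin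 (8 + 1)) ℂ) {Q, C} → (∀ H : MvPolynomial (Fin (8 + 1)) ℂ, H.IsHomogeneous 1 → H ≠ 0 → ¬ (Set.range ι.left.base ⊆ ProjectiveSpectrum.zeroLocus (MvPolynomial.homogeneousSubmodule (Fin (8 + 1)) ℂ) {H})) → (∀ a b : Literature.AlgebraicGeometry.Motives.ChowGroup X.left 1, ∃ m n : ℤ, (m ≠ 0 ∨ n ≠ 0) ∧ m • a = n • b)

/-- item stmt-HodgeConjecture-1787 · support · rank 9 · closed · moot by None · by planner
why it might fail: Known-type (Paranjape/Laterveer/Voisin II 10.29 adapted from Hodge numbers to Hodge classes); a slip is possible only in degrees 8/10, handled by the transposed decomposition (checked by hand).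
sources: VoisinHodgeII2003, Paranjape1994SmallChow, Laterveer1998, BlochSrinivas1983
[support] CONIVEAU LADDER, k_0 = 1, n = 6, for Hodge CLASSES: a smooth projective sixfold X/C with
CH_0 ⊗ Q and CH_1 ⊗ Q of rank <= 1 (⇒ cl injective on both, since points and curves have non-zero
degree) satisfies HodgeConjectureFor 6 X. Proof pattern: Paranjape–Laterveer decomposition
(VoisinHodgeII2003 Thm 10.29) m Δ = Z_0 + Z_1 + Z_2, Z_0 ⊂ X × pt, Z_1 ⊂ W'_1 × W_1 (dim W_1 = 1),
Z_2 ⊂ T × X (codim T >= 2); for a Hodge class α: degrees 2,4,6 use [Z]^*: Z_0, Z_1 act by 0 on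
H^{>=4} (restriction to a curve) and Z_2^* α = τ_*([Z~_2]^* α) with [Z~_2]^*α a Hodge class of
degree 2p − 4 on a resolution T~ of T (dim 4): degree 0 (fundamental classes), or degree 2 ⇒
algebraic by Lefschetz (1,1) (Literature LefschetzOneOne) ⇒ Gysin image algebraic; degrees 8, 10 use
the TRANSPOSED decomposition (Δ symmetric): τ^*α ∈ H^8(T~^4) = top degree (points) resp. 0, and Z_1
contributes multiples of [W_1] or 0; degrees 0, 12 trivial. Needs: Bloch–Srinivas/Paranjape
decomposition (named fact BlochSrinivas1983_decompositionOfTheDiagonal + its CH_1 iterate), Hironaka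
resolution, Gysin = morphism of Hodge structures, cup product of cycle classes algebraic (Fulton1998
§19.2), Lefschetz (1,1), nonempty_h -/
@[route_item "route-HodgeConjecture-schlafli-minus-five"]
def LadderHodgeSix : Prop :=
  ∀ ⦃X : Literature.AlgebraicGeometry.Motives.SchemeOver ℂ⦄, Literature.AlgebraicGeometry.Motives.IsSmoothProjective 6 X → (∀ a b : Literature.AlgebraicGeometry.Motives.ChowGroup X.left 0, ∃ m n : ℤ, (m ≠ 0 ∨ n ≠ 0) ∧ m • a = n • b) → (∀ a b : Literature.AlgebraicGeometry.Motives.ChowGroup X.left 1, ∃ m n : ℤ, (m ≠ 0 ∨ n ≠ 0) ∧ m • a = n • b) → Literature.AlgebraicGeometry.HodgeTheory.HodgeConjectureFor 6 X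

/-- item stmt-HodgeConjecture-1788 · support · rank 9 · closed · moot by None · by planner
why it might fail: Theorem (Fano ⇒ RCC ⇒ CH_0 = Z, Campana/KMM, Kollar1996 IV.3.13); rendering risk only.
sources: Kollar1996, TianZong2014
[support] CH_0 ⊗ Q of every smooth (2,3)-sixfold X ⊂ P^8 has rank <= 1 (indeed CH_0(X) = Z): X is
Fano (K_X = O(−4)), hence rationally chain connected (Campana 1992; Kollár–Miyaoka–Mori 1992;
Kollar1996 IV.3.13/V.2.13), hence all points rationally equivalent; more cheaply, through every
point of X passes a 2-dimensional family of lines (8 − 1 − 5 = 2) and any two lines meet a common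
third… (not needed). Why it might fail: theorem; rendering only. Sources: Kollar1996 Thm IV.3.13;
TianZong2014 §1 (RC ⇒ CH_0 = Z). -/
@[route_item "route-HodgeConjecture-schlafli-minus-five"]
def ChowZeroTrivial23 : Prop :=
  letI := MvPolynomial.gradedAlgebra (σ := Fin (8 + 1)) (R := ℂ); ∀ ⦃X : Literature.AlgebraicGeometry.Motives.SchemeOver ℂ⦄ (Q C : MvPolynomial (Fin (8 + 1)) ℂ) (ι : X ⟶ Literature.AlgebraicGeometry.Motives.projectiveSpace 8 ℂ), Literature.AlgebraicGeometry.Motives.IsSmoothProjective 6 X → Q.IsHomogeneous 2 → C.IsHomogeneous 3 → AlgebraicGeometry.IsClosedImmersion ι.left → Set.range ι.left.base = ProjectiveSpectrum.zeroLocus (MvPolynomial.homogeneousSubmodule (Fin (8 + 1)) ℂ) {Q, C} → (∀ H : MvPolynomial (Fin (8 + 1)) ℂ, H.IsHomogeneous 1 → H ≠ 0 → ¬ (Set.range ι.left.base ⊆ ProjectiveSpectrum.zeroLocus (MvPolynomial.homogeneousSubmodule (Fin (8 + 1)) ℂ) {H})) → (∀ a b : Literature.AlgebraicGeometry.Motives.ChowGroup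 X.left 0, ∃ m n : ℤ, (m ≠ 0 ∨ n ≠ 0) ∧ m • a = n • b)

/-- item stmt-HodgeConjecture-1789 · support · rank 10 · closed · moot by None · by planner
why it might fail: Pure cycle algebra over the tree's ChowGroup API; fails only if the renderings of 'line' in the two hypotheses and the quotient-group equality do not match up (then restate).
sources: Fulton1998, TianZong2014
[support] GLUE (cycle algebra, provable now): LinesGenerate23 → LinesEquivalentVeryGeneral23 →
ChowOneVeryGeneral23, decl names of this route (rendered before this item). Take the same
exceptional family G; for X = V(Q,C) with (Q,C) avoiding it: every class a ∈ CH_1(X) has m·a = Σ w_z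
[z] over finitely many lines z (LinesGenerate23 via ChowGroup.mk_surjective and mk_eq_mk_iff), and
k·[z] = k·[z_0] for any two lines; clearing denominators gives (m', n') ≠ (0,0) with m' a = n' b.
Uses only Literature.AlgebraicGeometry.Motives.ChowGroup.mk_eq_mk_iff / mk_surjective and
AddSubgroup algebra. Why it might fail: cannot (pure algebra), unless a rendering mismatch between
IsRationallyEquivalent on cycles and equality in ChowGroup X.left 1 surfaces — then restate.
Sources: Fulton1998 §1.3 (definitions), tree file Motives/Cycles.lean. -/
@[route_item "route-HodgeConjecture-schlafli-minus-five"]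
def ChowOneOfLines23 : Prop :=
  LinesGenerate23 → LinesEquivalentVeryGeneral23 → ChowOneVeryGeneral23

/-- item stmt-HodgeConjecture-1790 · assembly · rank 1 · closed · moot by None · by planner
why it might fail: Cannot fail mathematically (propositional glue); only an elaboration mismatch between the inlined copies (generated from one source string, Sketch.lean rc 0).
sources: VoisinHodgeII2003, Bai2024VoisinMaps
[assembly] ChowZeroTrivial23 → LadderHodgeSix → ChowOneVeryGeneral23 → ChowOneSpecialisation23 →
HodgeAllSmooth23, by decl name (items of this route, rendered above): for a smooth nondegenerate
(2,3)-sixfold X, ChowOneSpecialisation23 applied to ChowOneVeryGeneral23 gives rank CH_1(X)_Q <= 1,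
ChowZeroTrivial23 gives rank CH_0(X)_Q <= 1, and LadderHodgeSix gives HodgeConjectureFor 6 X. PURE
LOGIC (intro/apply; the leading `letI := MvPolynomial.gradedAlgebra …` of each statement
zeta-reduces) — a calibration item that kernel-checks the route's skeleton. It concludes the route's
Target (instance family), not Summit HodgeConjecture. Sources: the card schlafli-minus-five;
companion card coniveau-ladder-cubic-eightfolds (frame). -/
@[route_item "route-HodgeConjecture-schlafli-minus-five"]
def Assembly : Prop :=
  ChowZeroTrivial23 → LadderHodgeSix → ChowOneVeryGeneral23 → ChowOneSpecialisation23 → HodgeAllSmooth23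

end Summit.HodgeConjecture.HodgeConjecture.Theses.SchlafliMinusFive
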